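import Mathlib.RingTheory.Algebraic.Integral
import Literature.NumberTheory.EllipticCurves.PAdicHeightsLogProofs
import Literature.NumberTheory.Transcendental.MahlerManin
import HarnessLib

/-!
# The `𝓛`-invariant is nonzero, given Mahler–Manin (reduction; proofs only)

`PAdicHeights.lean` states the non-vanishing of the Mazur–Tate–Teitelbaum `𝓛`-invariant
`𝓛_p(E) = log_p q_E / ord_p q_E` of an elliptic curve `E/ℚ` with split multiplicative reduction
at `p` as the named fact `WeierstrassCurve.LInvariant_ne_zero`
[cite: BarreSirieixDiazGramainPhilibert1996Manin].  Its printed proof is one line on top of a deep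
theorem: by the **Mahler–Manin conjecture** (theorem of Barré-Sirieix–Diaz–Gramain–Philibert 1996,
vendored as the named fact `Literature.NumberTheory.Transcendental.MahlerManinPadic`) the Tate
parameter `q_E ∈ ℚ_p` — which satisfies `J(q_E) = j(E) ∈ ℚ` — is transcendental, whereas
`log_p q = 0` forces `q ∈ p^ℤ · μ(ℚ_p)` (kernel of the Iwasawa logarithm,
`Literature.NumberTheory.EllipticCurves.padicLog_eq_zero_iff_holds`, proved in
`PAdicHeightsLogProofs.lean`), i.e. `q` algebraic.  This file proves exactly this reduction:

* `Literature.NumberTheory.EllipticCurves.isAlgebraic_of_mul_zpow_pow_eq_one`: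
  `(x p^{-n})^k = 1`, `k > 0` ⇒ `x` algebraic over `ℚ`;
* `WeierstrassCurve.TateParameterData.transcendental_q`: given `MahlerManinPadic`, the Tate
  parameter of `E/ℚ` at `p` is transcendental over `ℚ`;
* `WeierstrassCurve.TateParameterData.padicLog_q_ne_zero`: given `MahlerManinPadic`,
  `log_p q_E ≠ 0`;
* `WeierstrassCurve.LInvariant_ne_zero_of_mahlerManin :
    MahlerManinPadic → LInvariant_ne_zero` — the conditional discharge; the trust base of
  `LInvariant_ne_zero` is thereby reduced to the single named fact `MahlerManinPadic`
  (BDGP 1996, Théorème 1), whose formal proof is a theory-sized programme (see the module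
  docstring of `Transcendental/MahlerManin.lean`).

The `WeierstrassCurve` declarations are deliberate dot-notation extensions of Mathlib's namespace,
as in `PAdicHeights.lean`.

## References

* [BarreSirieixDiazGramainPhilibert1996Manin] K. Barré-Sirieix, G. Diaz, F. Gramain,
  G. Philibert, *Une preuve de la conjecture de Mahler–Manin*, Invent. Math. 124 (1996) 1–9,
  Théorème 1 and its corollary for `log_p q`.
* [MazurTateTeitelbaum1986Invent] B. Mazur, J. Tate, J. Teitelbaum, Invent. Math. 84 (1986),
  §II.1 (definition of `𝓛_p(E)`; the non-vanishing was conjectured there and noted to follow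
  from Manin's conjecture).
* [NesterenkoPhilippon2001] Ch. 2 (G. Diaz), Thm. 2.11.
-/

noncomputable section

namespace Literature.NumberTheory.EllipticCurves

variable {p : ℕ} [Fact p.Prime]

/-- An element of `p^ℤ · μ(ℚ_p)` is algebraic over `ℚ`: if `(x · p^{-n})^k = 1` with `k > 0`
then `x` is algebraic (`x p^{-n}` is a root of unity, `p^n ∈ ℚ`). [folklore] -/
theorem isAlgebraic_of_mul_zpow_pow_eq_one {x : ℚ_[p]} {n : ℤ} {k : ℕ} (hk : 0 < k)
    (h : (x * (p : ℚ_[p]) ^ (-n)) ^ k = 1) : IsAlgebraic ℚ x := by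
  have hp0 : (p : ℚ_[p]) ≠ 0 := Nat.cast_ne_zero.mpr (Fact.out : p.Prime).ne_zero
  have hw : IsAlgebraic ℚ (x * (p : ℚ_[p]) ^ (-n)) :=
    IsAlgebraic.of_pow hk (by rw [h]; exact isAlgebraic_one)
  have hpn : IsAlgebraic ℚ ((p : ℚ_[p]) ^ n) := by
    simpa using isAlgebraic_algebraMap (R := ℚ) (A := ℚ_[p]) ((p : ℚ) ^ n)
  have := hw.mul hpn
  rwa [mul_assoc, ← zpow_add₀ hp0, neg_add_cancel, zpow_zero, mul_one] at this

end Literature.NumberTheory.EllipticCurves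

namespace WeierstrassCurve

open Literature.NumberTheory.EllipticCurves Literature.NumberTheory.Transcendental

variable {W : WeierstrassCurve ℚ} {p : ℕ} [Fact p.Prime]

namespace TateParameterData

/-- **The Tate parameter is transcendental** (given Mahler–Manin): `q_E ≠ 0`, `‖q_E‖_p < 1` and
`J(q_E) = j(E) ∈ ℚ` is algebraic, so `q_E` algebraic would contradict `MahlerManinPadic`
(BDGP 1996, Théorème 1, `p`-adic case). [cite: BarreSirieixDiazGramainPhilibert1996Manin, Théorème 1] -/
theorem transcendental_q (hMM : MahlerManinPadic) [W.IsElliptic] (D : TateParameterData W p) :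
    Transcendental ℚ D.q := by
  refine hMM.transcendental_of_isAlgebraic_tateJ p D.q_ne_zero D.norm_q_lt_one ?_
  rw [D.tateJ_eq]
  simpa using isAlgebraic_algebraMap (R := ℚ) (A := ℚ_[p]) W.j

/-- **`log_p q_E ≠ 0`** (given Mahler–Manin): `log_p q_E = 0` would put `q_E` in
`ker log_p = p^ℤ · μ(ℚ_p)` (`padicLog_eq_zero_iff_holds`), making it algebraic, against
`transcendental_q`. [cite: BarreSirieixDiazGramainPhilibert1996Manin, Théorème 1] -/
theorem padicLog_q_ne_zero (hMM : MahlerManinPadic) [W.IsElliptic] (D : TateParameterData W p) :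
    padicLog p D.q ≠ 0 := by
  intro h0
  obtain ⟨n, k, hk, hw⟩ := (padicLog_eq_zero_iff_holds p D.q_ne_zero).mp h0
  exact D.transcendental_q hMM (isAlgebraic_of_mul_zpow_pow_eq_one hk hw)

end TateParameterData

/-- **Non-vanishing of the `𝓛`-invariant, conditional discharge of
`WeierstrassCurve.LInvariant_ne_zero`**: assuming the Mahler–Manin theorem
(`Literature.NumberTheory.Transcendental.MahlerManinPadic`, BDGP 1996 Théorème 1), for every
`E/ℚ` and every Tate parameter datum `D` at `p` one has `𝓛_p(E) = log_p q_E / ord_p q_E ≠ 0`: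
the numerator is nonzero by `TateParameterData.padicLog_q_ne_zero` and the denominator by
`TateParameterData.valuation_q_pos`.  The unconditional `LInvariant_ne_zero_holds` awaits a
formal proof of `MahlerManinPadic`. [cite: BarreSirieixDiazGramainPhilibert1996Manin, Théorème 1] -/
theorem LInvariant_ne_zero_of_mahlerManin (hMM : MahlerManinPadic) :
    LInvariant_ne_zero (W := W) (p := p) := by
  intro _ D
  rw [LInvariant, div_ne_zero_iff]
  refine ⟨D.padicLog_q_ne_zero hMM, ?_⟩
  exact_mod_cast D.valuation_q_pos.ne'

end WeierstrassCurve

end
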